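import Summits.BirchSwinnertonDyer.BirchSwinnertonDyer.Theorems.SignedBaseChangeRev14Glue

/-!
# SignedBaseChange — closer of the readiness glue item `SignedTwoVariableInputsGlue`
(stmt-BirchSwinnertonDyer-20552, rev 18 split of `SignedTwoVariableInputs` into its two cite-only
BY-NAME conjuncts `BCSGreenbergMuInvariantMinus`, `BSTWSignedTwoVariablePackagePRE`; PUB pattern,
director token W-15 / 14:54:34Z (ii)). One line over the landed by-name glue
`SignedBaseChangeRev14Glue.signedTwoVariableInputs_of_facts` (p541190). Planner bsd-wall-ss g6.
-/

namespace Summit.BirchSwinnertonDyer.BirchSwinnertonDyer.Theorems.SignedBaseChangeInputsGlueCloser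

open Summit.BirchSwinnertonDyer.BirchSwinnertonDyer.Theses.SignedBaseChange

/-- `BCSGreenbergMuInvariantMinus → BSTWSignedTwoVariablePackagePRE → SignedTwoVariableInputs`. -/
theorem signedTwoVariableInputsGlue_holds : SignedTwoVariableInputsGlue :=
  fun h₁ h₂ => SignedBaseChangeRev14Glue.signedTwoVariableInputs_of_facts h₁ h₂

end Summit.BirchSwinnertonDyer.BirchSwinnertonDyer.Theorems.SignedBaseChangeInputsGlueCloser
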